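import Mathlib
import Summits.Ventures.HodgeRepro.Tier4.Common.Geometry
import Summits.Ventures.HodgeRepro.BallTopology
import Summits.Ventures.HodgeRepro.BallCore

/-!
# Tier4/Common/BallRealisation — the forms of `X` on the sealed ball model, the Hecke translates as elements of
`U(2,1)`, and the non-vanishing of `f^*Ω_s`, `f^*Ω_{s̄}` for some translates (the sealed statement (c) at work)

Blind re-derivation cell `pub-hodge-repro`, Tier 4 (README §9–§10), seat t4-typer-1 (gen 0).  Target tree path
`lean/Summits/Ventures/HodgeRepro/Tier4/Common/BallRealisation.lean`.  Imports `Tier4/Common/Geometry.lean`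
(`Witness`, `pullOmegaS`, `pullOmegaSbar`), the sealed ball model through the landed `BallTopology.lean`
(`BallModel.Ball`, `U21`, `act`, `Jac`, `wedge`, `pullback`, `isOpen_wedge_ne`) and the landed Tier-2 core
`BallCore.lean` (`BallCore.exists_wedge_ne_zero`: some element of `U(2,1)` and some point give a non-zero wedge of
two non-zero cotangent fields — the algebraic half of the sealed statement (c) `HeckeTranslateWedge`, proved by the
cell as `heckeTranslateWedge`).

WHAT IS TYPED.  `X = Γ\𝔹²` for a cocompact torsion-free lattice `Γ ≤ U(2,1)`, and its congruence covers: a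
holomorphic `1`-form on a cover is a Γ′-automorphic holomorphic cotangent field `F = F₀ dz₀ + F₁ dz₁` on the ball,
a holomorphic `2`-form is `h dz₀ ∧ dz₁` with `h` a Γ′-automorphic holomorphic function, the wedge of two `1`-forms
is the pointwise wedge `F ∧ G = F₀G₁ − F₁G₀` (the sealed `BallModel.wedge`), and a Hecke translate by
`γ ∈ G(ℚ) ⊂ U(2,1)` pulls a form back along `z ↦ γz` — `(γ^*F)(z) = J_γ(z)ᵀ F(γz)` (the sealed `pullback`) — to a form
on a deeper cover (the common congruence cover on which `f` is defined, ROUTE.md §4 item 2).  `BallRealisation W`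
records this as parameters: the lifts `lift1`, `lift2` (ℂ-linear, injective, continuous on `1`-forms), the
compatibility of the wedge with the pointwise wedge, the realisation `toU21` of the Hecke translates as elements of
`U(2,1)` acting by the sealed pull-back, and the DENSITY of the Hecke translates in `U(2,1)` (the rational points of
the unitary group are dense in the real group — real approximation, the landed `LitRealApproxHolds`).

WHAT IS PROVED.  `exists_pullOmegaS_ne_zero`: for some choice of the Hecke translates the `2`-form
`f^*Ω_s = T_{γ_0}^*ω_0 ∧ T_{γ_1}^*ω_1` is NON-ZERO (the sealed (c): a non-zero pointwise wedge at some point for some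
`γ ∈ U(2,1)`, moved into the dense set of translates by the openness of the non-vanishing locus); likewise
`exists_pullOmegaSbar_ne_zero`, and `exists_both_ne_zero` for a SINGLE choice `γ = (γ_0, 1, γ_2, 1)`.  This is the
NECESSARY half of (P) (`Witness.ne_zero_of_hodgePairing_ne_zero`: a non-zero pairing needs both `2`-forms
non-zero), kernel-proved from the sealed Tier-2 statement; it says nothing about the pairing of the two non-zero
`2`-forms, which is the mathematics of the lines.

WHAT AN INTERFACE CAN AND CANNOT SAY.  Every field is a parameter; a theorem proved over these structures is a
theorem about every instantiation and exactly as strong as the listed properties.  Nothing here says anything about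
the status of the Hodge conjecture for CM abelian varieties, which is NOT proved (HC_CM is NOT proved by anyone in
this repository).
-/

set_option autoImplicit false

noncomputable section

namespace Summit.Ventures.HodgeRepro.Tier4.Common

open Summit.Ventures.HodgeRepro BallModel

/-- **The ball realisation of the witness `X`**: the holomorphic forms of `X` (and of its congruence covers) as
cotangent fields / functions on the sealed ball `𝔹²`, the Hecke translates as elements of `U(2,1)` acting by the
sealed pull-back, dense in `U(2,1)`. -/
structure BallRealisation {Form : Type} [AddCommGroup Form] [Module ℂ Form] {A : FormAlgebra Form}
    (W : Witness A) where
  /-- the lift of a `1`-form to a cotangent field `F = F₀ dz₀ + F₁ dz₁` on the ball, ℂ-linear -/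
  lift1 : Form →ₗ[ℂ] (Ball → Fin 2 → ℂ)
  /-- the lift of a `2`-form `h dz₀ ∧ dz₁` to its coefficient function `h` on the ball, ℂ-linear -/
  lift2 : Form →ₗ[ℂ] (Ball → ℂ)
  /-- the lift of a holomorphic `1`-form is continuous -/
  continuous_lift1 : ∀ α : Form, α ∈ A.H10 → Continuous (lift1 α)
  /-- a holomorphic `1`-form with zero lift is zero (forms on `X` are the automorphic forms on the ball) -/
  lift1_injective : ∀ α : Form, α ∈ A.H10 → lift1 α = 0 → α = 0
  /-- a holomorphic `2`-form with zero lift is zero -/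
  lift2_injective : ∀ β : Form, β ∈ A.H20 → lift2 β = 0 → β = 0
  /-- the wedge of two `1`-forms lifts to the pointwise wedge `F₀G₁ − F₁G₀` -/
  lift2_wedge : ∀ α β : Form, α ∈ A.H10 → β ∈ A.H10 → ∀ z : Ball,
    lift2 (A.wedge α β) z = wedge (lift1 α z) (lift1 β z)
  /-- the Hecke translate `T` as an element of `U(2,1)` -/
  toU21 : W.Hecke → U21
  /-- the identity correspondence is the identity of `U(2,1)` -/
  toU21_one : toU21 W.one = 1
  /-- a Hecke translate acts on the lift of a `1`-form by the sealed pull-back `(γ^*F)(z) = J_γ(z)ᵀ F(γz)` -/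
  lift1_translate : ∀ (T : W.Hecke) (α : Form), α ∈ A.H10 →
    lift1 (W.translate T α) = pullback (toU21 T) (lift1 α)
  /-- the Hecke translates are dense in `U(2,1)` (real approximation for the rational points) -/
  dense : Dense (Set.range toU21)

namespace BallRealisation

variable {Form : Type} [AddCommGroup Form] [Module ℂ Form] {A : FormAlgebra Form} {W : Witness A}

/-- The lift of a non-zero holomorphic `1`-form is non-zero at some point. -/
theorem exists_lift1_ne_zero (R : BallRealisation W) (α : Form) (hα : α ∈ A.H10) (h : α ≠ 0) : ∃ z : Ball, R.lift1 α z ≠ 0 := by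
  by_contra hcon
  simp only [not_exists, not_not] at hcon
  exact h (R.lift1_injective α hα (funext hcon))

/-- **The sealed statement (c) on the witness**: for two non-zero holomorphic `1`-forms `α, β` of `X` there is a
Hecke translate `T` with `T^*α ∧ β ≠ 0` (a non-zero pointwise wedge at some point, moved into the dense set of
translates by the openness of the non-vanishing locus, `BallModel.isOpen_wedge_ne`). -/
theorem exists_translate_wedge_ne_zero (R : BallRealisation W) (α β : Form) (hα : α ∈ A.H10) (hβ : β ∈ A.H10) (hα0 : α ≠ 0)
    (hβ0 : β ≠ 0) : ∃ T : W.Hecke, A.wedge (W.translate T α) β ≠ 0 := by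
  obtain ⟨γ₀, z, h₀⟩ := BallCore.exists_wedge_ne_zero (R.lift1 α) (R.lift1 β)
    (R.exists_lift1_ne_zero α hα hα0) (R.exists_lift1_ne_zero β hβ hβ0)
  obtain ⟨γ, ⟨T, rfl⟩, hγ⟩ := R.dense.exists_mem_open
    (isOpen_wedge_ne (R.continuous_lift1 α hα) (R.continuous_lift1 β hβ) z) ⟨γ₀, h₀⟩
  refine ⟨T, fun hzero => ?_⟩
  have hmem : W.translate T α ∈ A.H10 := W.translate_H10 T α hα
  have h1 : R.lift2 (A.wedge (W.translate T α) β) z = wedge (R.lift1 (W.translate T α) z) (R.lift1 β z) :=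
    R.lift2_wedge _ _ hmem hβ z
  rw [hzero, map_zero, R.lift1_translate T α hα] at h1
  exact hγ (by simpa [pullback] using h1.symm)

/-- **`f^*Ω_s ≠ 0` for some Hecke translates**: `γ = (T, 1, 1, 1)` with `T^*ω_0 ∧ ω_1 ≠ 0`. -/
theorem exists_pullOmegaS_ne_zero (R : BallRealisation W) : ∃ γ : W.Translates, W.pullOmegaS γ ≠ 0 := by
  obtain ⟨T, hT⟩ := R.exists_translate_wedge_ne_zero (W.omega 0) (W.omega 1) (W.omega_mem 0) (W.omega_mem 1)
    (W.omega_ne 0) (W.omega_ne 1)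
  refine ⟨![T, W.one, W.one, W.one], ?_⟩
  simpa [Witness.pullOmegaS, Witness.pullOmega, W.translate_one] using hT

/-- **`f^*Ω_{s̄} ≠ 0` for some Hecke translates**: `γ = (1, 1, T, 1)` with `T^*ω_2 ∧ ω_3 ≠ 0`. -/
theorem exists_pullOmegaSbar_ne_zero (R : BallRealisation W) : ∃ γ : W.Translates, W.pullOmegaSbar γ ≠ 0 := by
  obtain ⟨T, hT⟩ := R.exists_translate_wedge_ne_zero (W.omega 2) (W.omega 3) (W.omega_mem 2) (W.omega_mem 3)
    (W.omega_ne 2) (W.omega_ne 3)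
  refine ⟨![W.one, W.one, T, W.one], ?_⟩
  simpa [Witness.pullOmegaSbar, Witness.pullOmega, W.translate_one] using hT

/-- **Both `2`-forms non-zero for ONE choice of the Hecke translates** `γ = (T_0, 1, T_2, 1)` — the necessary half
of (P). -/
theorem exists_both_ne_zero (R : BallRealisation W) : ∃ γ : W.Translates, W.pullOmegaS γ ≠ 0 ∧ W.pullOmegaSbar γ ≠ 0 := by
  obtain ⟨T₀, h₀⟩ := R.exists_translate_wedge_ne_zero (W.omega 0) (W.omega 1) (W.omega_mem 0) (W.omega_mem 1)
    (W.omega_ne 0) (W.omega_ne 1)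
  obtain ⟨T₂, h₂⟩ := R.exists_translate_wedge_ne_zero (W.omega 2) (W.omega 3) (W.omega_mem 2) (W.omega_mem 3)
    (W.omega_ne 2) (W.omega_ne 3)
  refine ⟨![T₀, W.one, T₂, W.one], ?_, ?_⟩
  · simpa [Witness.pullOmegaS, Witness.pullOmega, W.translate_one] using h₀
  · simpa [Witness.pullOmegaSbar, Witness.pullOmega, W.translate_one] using h₂

end BallRealisation

end Summit.Ventures.HodgeRepro.Tier4.Common
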